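import Literature.Topology.FourManifolds.KhCurlHomotopyNeg
import HarnessLib

/-!
# Invariance of Khovanov homology under the first Reidemeister move (`Ω1a`, `Ω1b`)

Sibling file of `KhComplex.lean`, assembling `KhCurlHomotopyPos` / `KhCurlHomotopyNeg` (the curl at
the last two positions) and `KhComplexTransportProofs` (independence of the base point) into the
two first-move cases of the named fact
`Literature.Topology.FourManifolds.GaussDiagram.nonempty_iso_khovanovHomology_of_equiv`
(Khovanov (2000), Thm. 1), for **every** Gauss diagram (no realisability hypothesis):

* `insertChord_castSucc_eq_rotate_curl`, `insertChord_succ_eq_rotate_curl` — the targets of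
  `PolyakMove.omega1a G p ε` / `PolyakMove.omega1b G p ε` (an isolated chord at the adjacent
  positions `p, p + 1`) are rotations of the curl at the last two positions of a rotation of `G`:
  `G.insertChord p.castSucc p ε = ((G.rotate (2n - p)).curl true ε).rotate (p + 2)`;
* `nonempty_iso_khovanovHomology_omega1a`, `nonempty_iso_khovanovHomology_omega1b` —
  **`Kh^{i,j}(G) ≅ Kh^{i,j}(G.insertChord p.castSucc p ε)` and
  `Kh^{i,j}(G) ≅ Kh^{i,j}(G.insertChord p.succ p ε)`**, and the same for the homology over the
  universal Frobenius system (`nonempty_iso_frobeniusHomology_omega1a/b`), every `(R, h, t)`.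

Khovanov (2000), §5.1–5.2, Thm. 1; Bar-Natan (2002), §4; Polyak (2010), §2 (the moves `Ω1a–d`).
No named fact is introduced.

## References

* M. Khovanov, *A categorification of the Jones polynomial*, Duke Math. J. 101 (2000) 359–426,
  §5.1–5.2, Thm. 1. [cite: Khovanov2000, Thm. 1]
* D. Bar-Natan, *On Khovanov's categorification of the Jones polynomial*, Algebr. Geom. Topol. 2
  (2002) 337–370, §4. [cite: BarNatan2002, §4]
* M. Polyak, *Minimal generating sets of Reidemeister moves*, Quantum Topol. 1 (2010), §2,
  Fig. 2. [cite: Polyak2010, §2]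
-/

open Function

noncomputable section

namespace Literature.Topology.FourManifolds

namespace GaussDiagram

/-! ## Extensionality of Gauss diagrams by values -/

/-- Two Gauss diagrams with the same number of chords, the same positions (as numbers) of all
passages and the same signs are equal (indices compared through their values, to avoid casts).
[folklore] -/
theorem ext_of_val {G₁ G₂ : GaussDiagram} (hn : G₁.n = G₂.n)
    (ho : ∀ (i : Fin G₁.n) (j : Fin G₂.n), (i : ℕ) = j → (G₁.overPos i : ℕ) = G₂.overPos j)
    (hu : ∀ (i : Fin G₁.n) (j : Fin G₂.n), (i : ℕ) = j → (G₁.underPos i : ℕ) = G₂.underPos j)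
    (hs : ∀ (i : Fin G₁.n) (j : Fin G₂.n), (i : ℕ) = j → G₁.sign i = G₂.sign j) : G₁ = G₂ := by
  obtain ⟨n₁, o₁, u₁, s₁, b₁⟩ := G₁
  obtain ⟨n₂, o₂, u₂, s₂, b₂⟩ := G₂
  simp only at hn
  subst hn
  have h1 : o₁ = o₂ := funext fun i ↦ Fin.ext (ho i i rfl)
  have h2 : u₁ = u₂ := funext fun i ↦ Fin.ext (hu i i rfl)
  have h3 : s₁ = s₂ := funext fun i ↦ hs i i rfl
  subst h1; subst h2; subst h3
  rfl

/-! ## Positions of an isolated chord and of the rotated curl -/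

section Values

variable (G : GaussDiagram) (p : Fin (2 * G.n + 1))

/-- The old point `q` after inserting the isolated chord of `Ω1a` at `p, p + 1`: `q` if `q < p`,
`q + 2` otherwise. [folklore] -/
theorem val_insEmb_castSucc (q : Fin (2 * G.n)) :
    (G.insEmb p.castSucc p q : ℕ) = if q.val < p.val then q.val else q.val + 2 := by
  unfold insEmb
  split_ifs with h
  · rw [Fin.succAbove_of_castSucc_lt p q (Fin.lt_def.2 (by simpa using h)),
      Fin.succAbove_of_castSucc_lt _ _ (Fin.lt_def.2 (by simpa using h))]
    simp
  · rw [Fin.succAbove_of_le_castSucc p q (Fin.le_def.2 (by simpa using Nat.le_of_not_lt h)),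
      Fin.succAbove_of_le_castSucc _ _ (Fin.le_def.2 (by simp [Fin.val_succ]; omega))]
    simp [Fin.val_succ]

/-- The old point `q` after inserting the isolated chord of `Ω1b` at `p, p + 1`: `q` if `q < p`,
`q + 2` otherwise. [folklore] -/
theorem val_insEmb_succ (q : Fin (2 * G.n)) :
    (G.insEmb p.succ p q : ℕ) = if q.val < p.val then q.val else q.val + 2 := by
  unfold insEmb
  split_ifs with h
  · rw [Fin.succAbove_of_castSucc_lt p q (Fin.lt_def.2 (by simpa using h)),
      Fin.succAbove_of_castSucc_lt _ _ (Fin.lt_def.2 (by simp [Fin.val_succ]; omega))]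
    simp
  · rw [Fin.succAbove_of_le_castSucc p q (Fin.le_def.2 (by simpa using Nat.le_of_not_lt h)),
      Fin.succAbove_of_le_castSucc _ _ (Fin.le_def.2 (by simp [Fin.val_succ]; omega))]
    simp [Fin.val_succ]

/-- The value of a rotated over-passage. [folklore] -/
theorem val_rotate_overPos (k : ℕ) (i : Fin G.n) :
    ((G.rotate k).overPos i : ℕ) = ((G.overPos i : ℕ) + k) % (2 * G.n) :=
  val_rotPos G k (G.overPos i)

/-- The value of a rotated under-passage. [folklore] -/
theorem val_rotate_underPos (k : ℕ) (i : Fin G.n) :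
    ((G.rotate k).underPos i : ℕ) = ((G.underPos i : ℕ) + k) % (2 * G.n) :=
  val_rotPos G k (G.underPos i)

end Values

/-! ## Modular arithmetic of the conjugation -/

section Arith

/-- Rotating an old point `q < p` by `2n - p`. [folklore] -/
theorem rot_sub_of_lt {q p n : ℕ} (h : q < p) (hp : p ≤ 2 * n) :
    (q + (2 * n - p)) % (2 * n) = q + 2 * n - p := by
  rw [Nat.mod_eq_of_lt (by omega)]; omega

/-- Rotating an old point `q ≥ p` by `2n - p`. [folklore] -/
theorem rot_sub_of_le {q p n : ℕ} (h : p ≤ q) (hq : q < 2 * n) :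
    (q + (2 * n - p)) % (2 * n) = q - p := by
  rw [show q + (2 * n - p) = (q - p) + 2 * n by omega, Nat.add_mod_right, Nat.mod_eq_of_lt (by omega)]

/-- Rotating back the image of an old point `q < p`. [folklore] -/
theorem rot_back_of_lt {q p n : ℕ} (h : q < p) (hp : p ≤ 2 * n) :
    (q + 2 * n - p + (p + 2)) % (2 * (n + 1)) = q := by
  rw [show q + 2 * n - p + (p + 2) = q + 2 * (n + 1) by omega, Nat.add_mod_right,
    Nat.mod_eq_of_lt (by omega)]

/-- Rotating back the image of an old point `q ≥ p`. [folklore] -/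
theorem rot_back_of_le {q p n : ℕ} (h : p ≤ q) (hq : q < 2 * n) :
    (q - p + (p + 2)) % (2 * (n + 1)) = q - p + (p + 2) :=
  Nat.mod_eq_of_lt (by omega)

/-- Rotating back the first point of the curl. [folklore] -/
theorem rot_back_fst {p n : ℕ} (hp : p ≤ 2 * n) : (2 * n + (p + 2)) % (2 * (n + 1)) = p := by
  rw [show 2 * n + (p + 2) = p + 2 * (n + 1) by ring, Nat.add_mod_right, Nat.mod_eq_of_lt (by omega)]

/-- Rotating back the second point of the curl. [folklore] -/
theorem rot_back_snd {p n : ℕ} (hp : p ≤ 2 * n) : (2 * n + 1 + (p + 2)) % (2 * (n + 1)) = p + 1 := by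
  rw [show 2 * n + 1 + (p + 2) = (p + 1) + 2 * (n + 1) by ring, Nat.add_mod_right,
    Nat.mod_eq_of_lt (by omega)]

end Arith

/-! ## The isolated chord is a rotated curl -/

section Conjugate

variable (G : GaussDiagram) (p : Fin (2 * G.n + 1)) (ε : ℤˣ)

/-- The over-passage of an old chord in the conjugated curl. [folklore] -/
theorem val_overPos_rotate_curl_rotate_castSucc (tf : Bool) (i : Fin G.n) :
    ((((G.rotate (2 * G.n - p)).curl tf ε).rotate (p + 2)).overPos i.castSucc : ℕ) =
      if (G.overPos i : ℕ) < p then (G.overPos i : ℕ) else (G.overPos i : ℕ) + 2 := by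
  have hp := p.isLt; have hq := (G.overPos i).isLt
  rw [val_rotate_overPos]
  show ((((G.rotate (2 * G.n - p)).curl tf ε).overPos
    (Fin.castSucc (i : Fin (G.rotate (2 * G.n - p)).n)) : ℕ) + (p + 2)) %
      (2 * ((G.rotate (2 * G.n - p)).curl tf ε).n) = _
  rw [overPos_curl_castSucc]
  simp only [Fin.val_castSucc, val_rotate_overPos, curl_n, rotate_n]
  split_ifs with h
  · rw [rot_sub_of_lt h (by omega), rot_back_of_lt h (by omega)]
  · rw [rot_sub_of_le (Nat.le_of_not_lt h) hq, rot_back_of_le (Nat.le_of_not_lt h) hq]; omega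

/-- The under-passage of an old chord in the conjugated curl. [folklore] -/
theorem val_underPos_rotate_curl_rotate_castSucc (tf : Bool) (i : Fin G.n) :
    ((((G.rotate (2 * G.n - p)).curl tf ε).rotate (p + 2)).underPos i.castSucc : ℕ) =
      if (G.underPos i : ℕ) < p then (G.underPos i : ℕ) else (G.underPos i : ℕ) + 2 := by
  have hp := p.isLt; have hq := (G.underPos i).isLt
  rw [val_rotate_underPos]
  show ((((G.rotate (2 * G.n - p)).curl tf ε).underPos
    (Fin.castSucc (i : Fin (G.rotate (2 * G.n - p)).n)) : ℕ) + (p + 2)) %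
      (2 * ((G.rotate (2 * G.n - p)).curl tf ε).n) = _
  rw [underPos_curl_castSucc]
  simp only [Fin.val_castSucc, val_rotate_underPos, curl_n, rotate_n]
  split_ifs with h
  · rw [rot_sub_of_lt h (by omega), rot_back_of_lt h (by omega)]
  · rw [rot_sub_of_le (Nat.le_of_not_lt h) hq, rot_back_of_le (Nat.le_of_not_lt h) hq]; omega

/-- The over-passage of the curl chord in the conjugated curl. [folklore] -/
theorem val_overPos_rotate_curl_rotate_last (tf : Bool) :
    ((((G.rotate (2 * G.n - p)).curl tf ε).rotate (p + 2)).overPos (Fin.last G.n) : ℕ) =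
      if tf then (p : ℕ) else (p : ℕ) + 1 := by
  have hp := p.isLt
  rw [val_rotate_overPos]
  show ((((G.rotate (2 * G.n - p)).curl tf ε).overPos (Fin.last (G.rotate (2 * G.n - p)).n) : ℕ) +
    (p + 2)) % (2 * ((G.rotate (2 * G.n - p)).curl tf ε).n) = _
  rw [overPos_curl_last]
  cases tf
  · simp only [Bool.false_eq_true, ↓reduceIte, val_curlSnd, curl_n, rotate_n]
    exact rot_back_snd (by omega)
  · simp only [↓reduceIte, val_curlFst, curl_n, rotate_n]
    exact rot_back_fst (by omega)

/-- The under-passage of the curl chord in the conjugated curl. [folklore] -/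
theorem val_underPos_rotate_curl_rotate_last (tf : Bool) :
    ((((G.rotate (2 * G.n - p)).curl tf ε).rotate (p + 2)).underPos (Fin.last G.n) : ℕ) =
      if tf then (p : ℕ) + 1 else (p : ℕ) := by
  have hp := p.isLt
  rw [val_rotate_underPos]
  show ((((G.rotate (2 * G.n - p)).curl tf ε).underPos (Fin.last (G.rotate (2 * G.n - p)).n) : ℕ) +
    (p + 2)) % (2 * ((G.rotate (2 * G.n - p)).curl tf ε).n) = _
  rw [underPos_curl_last]
  cases tf
  · simp only [Bool.false_eq_true, ↓reduceIte, val_curlFst, curl_n, rotate_n]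
    exact rot_back_fst (by omega)
  · simp only [↓reduceIte, val_curlSnd, curl_n, rotate_n]
    exact rot_back_snd (by omega)

/-- **The target of `Ω1a` is a rotated curl**: inserting an isolated arrow, tail first, at the
adjacent positions `p, p + 1` is the curl (tail first) at the last two positions of the diagram
rotated by `2n - p`, rotated back by `p + 2`. GPV (2000), §1.2 (based Gauss diagrams);
Polyak (2010), §2. [cite: Polyak2010, §2] -/
theorem insertChord_castSucc_eq_rotate_curl :
    G.insertChord p.castSucc p ε = ((G.rotate (2 * G.n - p)).curl true ε).rotate (p + 2) := by
  refine ext_of_val rfl (fun i j hij ↦ ?_) (fun i j hij ↦ ?_) (fun i j hij ↦ ?_) <;>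
    induction i using Fin.lastCases with
    | last =>
      obtain rfl : j = Fin.last G.n := (Fin.ext hij).symm
      first
      | rw [insertChord_overPos_last, val_overPos_rotate_curl_rotate_last]; simp
      | rw [insertChord_underPos_last, Fin.succAbove_castSucc_self, val_underPos_rotate_curl_rotate_last]
        simp [Fin.val_succ]
      | rw [insertChord_sign_last]; exact (sign_curl_last _ true ε).symm
    | cast i =>
      obtain rfl : j = i.castSucc := (Fin.ext hij).symm
      first
      | rw [insertChord_overPos_castSucc_eq, val_insEmb_castSucc, val_overPos_rotate_curl_rotate_castSucc]
      | rw [insertChord_underPos_castSucc_eq, val_insEmb_castSucc, val_underPos_rotate_curl_rotate_castSucc]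
      | rw [insertChord_sign_castSucc]; exact (sign_curl_castSucc _ true ε i).symm

/-- **The target of `Ω1b` is a rotated curl**: inserting an isolated arrow, head first, at the
adjacent positions `p, p + 1` is the curl (head first) at the last two positions of the diagram
rotated by `2n - p`, rotated back by `p + 2`. GPV (2000), §1.2; Polyak (2010), §2.
[cite: Polyak2010, §2] -/
theorem insertChord_succ_eq_rotate_curl :
    G.insertChord p.succ p ε = ((G.rotate (2 * G.n - p)).curl false ε).rotate (p + 2) := by
  refine ext_of_val rfl (fun i j hij ↦ ?_) (fun i j hij ↦ ?_) (fun i j hij ↦ ?_) <;>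
    induction i using Fin.lastCases with
    | last =>
      obtain rfl : j = Fin.last G.n := (Fin.ext hij).symm
      first
      | rw [insertChord_overPos_last, val_overPos_rotate_curl_rotate_last]; simp [Fin.val_succ]
      | rw [insertChord_underPos_last, Fin.succAbove_succ_self, val_underPos_rotate_curl_rotate_last]
        simp
      | rw [insertChord_sign_last]; exact (sign_curl_last _ false ε).symm
    | cast i =>
      obtain rfl : j = i.castSucc := (Fin.ext hij).symm
      first
      | rw [insertChord_overPos_castSucc_eq, val_insEmb_succ, val_overPos_rotate_curl_rotate_castSucc]
      | rw [insertChord_underPos_castSucc_eq, val_insEmb_succ, val_underPos_rotate_curl_rotate_castSucc]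
      | rw [insertChord_sign_castSucc]; exact (sign_curl_castSucc _ false ε i).symm

end Conjugate

/-! ## The first Reidemeister move -/

section Omega1

variable (G : GaussDiagram) (p : Fin (2 * G.n + 1)) (ε : ℤˣ)

/-- **Integral Khovanov homology is invariant under `Ω1a`**: for every Gauss diagram `G`, every
position `p` and sign `ε`, `Kh^{i,j}(G) ≅ Kh^{i,j}(G.insertChord p.castSucc p ε)` (the target of
`PolyakMove.omega1a G p ε`). Khovanov (2000), §5.1–5.2, Thm. 1; Bar-Natan (2002), §4, Thm. 1;
Polyak (2010), §2. [cite: Khovanov2000, Thm. 1] -/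
theorem nonempty_iso_khovanovHomology_omega1a (i j : ℤ) :
    Nonempty (G.khovanovHomology i j ≅ (G.insertChord p.castSucc p ε).khovanovHomology i j) := by
  rw [insertChord_castSucc_eq_rotate_curl]
  obtain ⟨e₁⟩ := nonempty_iso_khovanovHomology_rotate G (2 * G.n - p) i j
  obtain ⟨e₂⟩ := nonempty_iso_khovanovHomology_curl (G := G.rotate (2 * G.n - p)) true ε i j
  obtain ⟨e₃⟩ := nonempty_iso_khovanovHomology_rotate ((G.rotate (2 * G.n - p)).curl true ε) (p + 2) i j
  exact ⟨e₁ ≪≫ e₂ ≪≫ e₃⟩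

/-- **Integral Khovanov homology is invariant under `Ω1b`**: for every Gauss diagram `G`, every
position `p` and sign `ε`, `Kh^{i,j}(G) ≅ Kh^{i,j}(G.insertChord p.succ p ε)` (the target of
`PolyakMove.omega1b G p ε`). Khovanov (2000), §5.1–5.2, Thm. 1; Bar-Natan (2002), §4, Thm. 1;
Polyak (2010), §2. [cite: Khovanov2000, Thm. 1] -/
theorem nonempty_iso_khovanovHomology_omega1b (i j : ℤ) :
    Nonempty (G.khovanovHomology i j ≅ (G.insertChord p.succ p ε).khovanovHomology i j) := by
  rw [insertChord_succ_eq_rotate_curl]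
  obtain ⟨e₁⟩ := nonempty_iso_khovanovHomology_rotate G (2 * G.n - p) i j
  obtain ⟨e₂⟩ := nonempty_iso_khovanovHomology_curl (G := G.rotate (2 * G.n - p)) false ε i j
  obtain ⟨e₃⟩ := nonempty_iso_khovanovHomology_rotate ((G.rotate (2 * G.n - p)).curl false ε) (p + 2) i j
  exact ⟨e₁ ≪≫ e₂ ≪≫ e₃⟩

variable {R : Type} [CommRing R] (h t : R)

/-- Homology over the universal Frobenius system does not depend on the base point. [folklore] -/
theorem nonempty_iso_frobeniusHomology_rotate (k : ℕ) (i : ℤ) :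
    Nonempty (G.frobeniusHomology R h t i ≅ (G.rotate k).frobeniusHomology R h t i) :=
  (G.rotateTransfer k).nonempty_iso_frobeniusHomology h t (fun _ ↦ 1) (fun _ ↦ by norm_num)
    (fun σ i' _ ↦ by
      show ((edgeSign σ i' : ℤ) : R) = 1 * 1 * (edgeSign σ i' : ℤ)
      ring) i

/-- **Khovanov homology over the universal Frobenius system is invariant under `Ω1a`**, for every
Gauss diagram and every `(R, h, t)` (in particular Lee homology). Khovanov (2000), §5, Thm. 1;
Khovanov (2006), Prop. 6; Bar-Natan (2002), §4. [cite: Khovanov2000, Thm. 1] -/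
theorem nonempty_iso_frobeniusHomology_omega1a (i : ℤ) :
    Nonempty (G.frobeniusHomology R h t i ≅ (G.insertChord p.castSucc p ε).frobeniusHomology R h t i) := by
  rw [insertChord_castSucc_eq_rotate_curl]
  obtain ⟨e₁⟩ := nonempty_iso_frobeniusHomology_rotate G h t (2 * G.n - p) i
  obtain ⟨e₂⟩ := nonempty_iso_frobeniusHomology_curl (G := G.rotate (2 * G.n - p)) true ε h t i
  obtain ⟨e₃⟩ := nonempty_iso_frobeniusHomology_rotate ((G.rotate (2 * G.n - p)).curl true ε) h t
    (p + 2) i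
  exact ⟨e₁ ≪≫ e₂ ≪≫ e₃⟩

/-- **Khovanov homology over the universal Frobenius system is invariant under `Ω1b`**, for every
Gauss diagram and every `(R, h, t)`. Khovanov (2000), §5, Thm. 1; Khovanov (2006), Prop. 6;
Bar-Natan (2002), §4. [cite: Khovanov2000, Thm. 1] -/
theorem nonempty_iso_frobeniusHomology_omega1b (i : ℤ) :
    Nonempty (G.frobeniusHomology R h t i ≅ (G.insertChord p.succ p ε).frobeniusHomology R h t i) := by
  rw [insertChord_succ_eq_rotate_curl]
  obtain ⟨e₁⟩ := nonempty_iso_frobeniusHomology_rotate G h t (2 * G.n - p) i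
  obtain ⟨e₂⟩ := nonempty_iso_frobeniusHomology_curl (G := G.rotate (2 * G.n - p)) false ε h t i
  obtain ⟨e₃⟩ := nonempty_iso_frobeniusHomology_rotate ((G.rotate (2 * G.n - p)).curl false ε) h t
    (p + 2) i
  exact ⟨e₁ ≪≫ e₂ ≪≫ e₃⟩

end Omega1

end GaussDiagram

end Literature.Topology.FourManifolds
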